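import Summits.CriticalPhenomena.Ising3D.ExclusionSentencesControl2DAlg

/-!
# Exclusion sentences — 2D control, third datum `c = 1/2` vs family `ALG` (cell `pub-ising3x`, seat recog-1, gen 6)

HONEST FRAMING: lottery ticket; floor = tightest certified 3D Ising CFT bounds; no exact-solution
claim without a proof.

The 2D control's third datum is the Virasoro central charge `c = 1/2` (SCOPE.md §4; recognised blind at 5 certified
digits in round R2).  Its `KAC`/`KACX` kind-`c` tables are in kernel form since gen 4 (`control_c_unique`,
`ExclusionSentencesControl2DC.lean`); FAMILIES-v1 applies `ALG`, `LIN`, `TRG` and `RAT` to kind `c` as well.  This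
file: `ALG` at the blind width — within `10⁻⁵` of `1/2` every real algebraic number of degree `d ≤ 6` and height
`≤ H_d` (table heights `1024/64/12/6/3/2`) is a root of `2X − 1`, i.e. IS `1/2` (`control_c_alg_unique`); exception
list from the Python twin `tools/alg_exceptions.py --lo 0.49999 --hi 0.50001` (`[[-1, 2]]`, member; degrees
`2…6` add nothing: `P(1/2) ∈ 2^{−d}ℤ` forces either `(2X − 1) ∣ P` — discharged by exact deflation — or
`|P(1/2)| ≥ 2^{−d}`, too large for a root within `10⁻⁵`).  Companion files: `ExclusionSentencesControl2DCLin.lean`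
(LIN), `ExclusionSentencesControl2DTrgGammaC7(Fin).lean` (TRG), `ExclusionSentencesControl2DRecognisedC.lean`
(the catalogue-wide statement).  No 3D digit is used anywhere.
-/

namespace Summit.CriticalPhenomena.Ising3D

/-- Degree 1, height `≤ 1024`: the only rational root with `max(|p|,|q|) ≤ 1024` within `10⁻⁵` of `1/2` is `1/2`. -/
theorem algExcluded_control_c_d1 :
    algExcluded 1 1024 (1 / 2 - 1 / 10 ^ 5) (1 / 2 + 1 / 10 ^ 5) 6 6 [[-1, 2]] = true := by
  decide +kernel

/-- Degree 2, height `≤ 64`. -/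
theorem algExcluded_control_c_d2 :
    algExcluded 2 64 (1 / 2 - 1 / 10 ^ 5) (1 / 2 + 1 / 10 ^ 5) 6 6 [[-1, 2]] = true := by
  decide +kernel

/-- Degree 3, height `≤ 12`. -/
theorem algExcluded_control_c_d3 :
    algExcluded 3 12 (1 / 2 - 1 / 10 ^ 5) (1 / 2 + 1 / 10 ^ 5) 6 6 [[-1, 2]] = true := by
  decide +kernel

/-- Degree 4, height `≤ 6`. -/
theorem algExcluded_control_c_d4 :
    algExcluded 4 6 (1 / 2 - 1 / 10 ^ 5) (1 / 2 + 1 / 10 ^ 5) 6 6 [[-1, 2]] = true := by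
  decide +kernel

/-- Degree 5, height `≤ 3`. -/
theorem algExcluded_control_c_d5 :
    algExcluded 5 3 (1 / 2 - 1 / 10 ^ 5) (1 / 2 + 1 / 10 ^ 5) 6 6 [[-1, 2]] = true := by
  decide +kernel

/-- Degree 6, height `≤ 2`. -/
theorem algExcluded_control_c_d6 :
    algExcluded 6 2 (1 / 2 - 1 / 10 ^ 5) (1 / 2 + 1 / 10 ^ 5) 6 6 [[-1, 2]] = true := by
  decide +kernel

/-- … and the degree-1 sentence is not vacuous: with an empty exception list the checker answers `false`
(it finds `2X − 1`). -/
theorem algExcluded_control_c_nonvacuous :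
    algExcluded 1 1024 (1 / 2 - 1 / 10 ^ 5) (1 / 2 + 1 / 10 ^ 5) 6 6 [] = false := by
  decide +kernel

/-- Printed shape: a real within `10⁻⁵` of `1/2` that is algebraic of some degree `d ≤ 6` within the table height
`H_d` of FAMILIES-v1 IS `1/2`. -/
theorem control_c_alg_unique {x : ℝ}
    (hx : ((1 / 2 - 1 / 10 ^ 5 : ℚ) : ℝ) ≤ x ∧ x ≤ ((1 / 2 + 1 / 10 ^ 5 : ℚ) : ℝ)) {d H : ℕ}
    (hdH : (d, H) ∈ algTable) (hmem : x ∈ algFamily d H) : x = 1 / 2 := by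
  have key : ∃ q ∈ [[-1, 2]], evalL q x = 0 := by
    simp only [algTable, List.mem_cons, Prod.mk.injEq, List.not_mem_nil, or_false] at hdH
    rcases hdH with ⟨rfl, rfl⟩ | ⟨rfl, rfl⟩ | ⟨rfl, rfl⟩ | ⟨rfl, rfl⟩ | ⟨rfl, rfl⟩ | ⟨rfl, rfl⟩
    · exact algExcluded_sound algExcluded_control_c_d1 hx hmem
    · exact algExcluded_sound algExcluded_control_c_d2 hx hmem
    · exact algExcluded_sound algExcluded_control_c_d3 hx hmem
    · exact algExcluded_sound algExcluded_control_c_d4 hx hmem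
    · exact algExcluded_sound algExcluded_control_c_d5 hx hmem
    · exact algExcluded_sound algExcluded_control_c_d6 hx hmem
  obtain ⟨q, hq, h0⟩ := key
  simp only [List.mem_singleton] at hq
  subst hq
  simp only [evalL_cons, evalL_nil] at h0
  push_cast at h0
  linarith

end Summit.CriticalPhenomena.Ising3D
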